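import Summits.MatrixMultiplication.MatrixMultiplication.Theses.StabilizerTensorRank

/-!
# Piece `StabDefectContraction` (stmt-MatrixMultiplication-17943, STEP leaf of `OmegaStabTwo`) — birth skeleton
`step-gain-amplification` (crux-strategist, per-piece skeleton of the decomposition of stmt-3827)

The piece: `∃ c > 0, ∀ k ≥ 1, ∀ r < 7^k, HasStabilizerScheme k r → ∃ m ≥ 1, ∃ r',
HasStabilizerScheme (m k) r' ∧ r' · (r/4^k)^(c m) ≤ r^m` (uniform self-improvement below the Strassen
frame). Birth skeleton = EXISTENCE of gain ∧ UNIFORMISATION of gain: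

* `stub_someGain` (qualitative Coppersmith–Winograd 1982 INSIDE the model; open, size L): every
  sub-Strassen stabilizer scheme has SOME Kronecker power that is strictly improvable in the model,
  `r' < r^m` at scale `m k`. (Classically true for every bilinear algorithm — CW82, SIAM J. Comput. 11 —
  via tensor power + degeneration + τ-theorem; the τ-step is not known to keep legs stabilizer.)
* `stub_amplify` (uniformisation; open, size XL — carries the rate): a rate `c > 0` such that ANY strict
  gain `r' < r^m` over a sub-Strassen input can be converted into a defect-power gain
  `r'' · D^(c m') ≤ r^(m')` at some scale `m' k`. (Kronecker powers of the gained scheme turn the ratio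
  `r^m / r'` into an exponential gain `(r^m/r')^t` at scale `t m k`, i.e. a rate
  `c_input = log(r^m/r') / (m log D)`; the stub says these rates are bounded below — or can be boosted —
  uniformly in the input.)
* `StabDefectContraction_of` — the piece from the two stubs (real proof).

Recommended constructive line (not typed here: needs border/direct-sum vocabulary as definitions):
border gain by a stabilizer laser/τ-step on the Kronecker square of the input + de-bordering inside the
model (pointwise-stabilizer border legs at `N > 2h` roots of unity interpolate to `≤ (2h+1)·r` exact
stabilizer terms; componentwise-stabilizer legs to `C(h+2,2)·r`).
-/

set_option linter.dupNamespace false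

noncomputable section

open scoped BigOperators

namespace Summit.MatrixMultiplication.MatrixMultiplication.Cruxes.OmegaStabTwo.StepGainAmplification

open Literature.Computability.AlgebraicComplexity

/-! ## The two stubs -/

/-- STUB 1 (existence of gain; stabilizer CW82, qualitative): some Kronecker power of every
sub-Strassen stabilizer scheme is strictly improvable inside the model.
[cite: CoppersmithWinograd1982 (classical analogue, Thm: every algorithm can be improved)] -/
theorem stub_someGain :
    ∀ k r : ℕ, 1 ≤ k → r < 7 ^ k → HasStabilizerScheme k r →
      ∃ m r' : ℕ, 1 ≤ m ∧ HasStabilizerScheme (m * k) r' ∧ r' < r ^ m := by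
  sorry

/-- STUB 2 (uniformisation of gain; carries the rate `c`): any strict gain over a sub-Strassen input
converts into a gain by a fixed power of the defect `D = r / 4^k` at some Kronecker-multiple scale.
[cite: Blaser2013, §7 (asymptotic sum inequality: the classical amplification device)] -/
theorem stub_amplify :
    ∃ c : ℝ, 0 < c ∧ ∀ k r m r' : ℕ, 1 ≤ k → r < 7 ^ k → 1 ≤ m →
      HasStabilizerScheme k r → HasStabilizerScheme (m * k) r' → r' < r ^ m →
      ∃ m' r'' : ℕ, 1 ≤ m' ∧ HasStabilizerScheme (m' * k) r'' ∧
        (r'' : ℝ) * ((r : ℝ) / 4 ^ k) ^ (c * m') ≤ (r : ℝ) ^ m' := by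
  sorry

/-! ## Composition: the piece from the stubs -/

/-- **`StabDefectContraction` from the line**: existence of gain (stub 1), then uniformisation
(stub 2). -/
theorem StabDefectContraction_of :
    Summit.MatrixMultiplication.MatrixMultiplication.Theses.StabilizerTensorRank.StabDefectContraction := by
  unfold Summit.MatrixMultiplication.MatrixMultiplication.Theses.StabilizerTensorRank.StabDefectContraction
  obtain ⟨c, hc, hamp⟩ := stub_amplify
  refine ⟨c, hc, fun k r hk hr hS => ?_⟩
  obtain ⟨m, r', hm, hS', hlt⟩ := stub_someGain k r hk hr hS
  obtain ⟨m', r'', hm', hS'', hineq⟩ := hamp k r m r' hk hr hm hS hS' hlt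
  exact ⟨m', r'', hm', hS'', hineq⟩

end Summit.MatrixMultiplication.MatrixMultiplication.Cruxes.OmegaStabTwo.StepGainAmplification

end
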